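import Summits.ValiantsHypothesis.ValiantsHypothesis.Theorems.MonotoneRestorationOrbitRestorationQPDerivativeTowerWaringAlt
import Summits.ValiantsHypothesis.ValiantsHypothesis.Theorems.MonotoneRestorationOrbitRestorationQPRestorable
import HarnessLib

/-!
# ΣΛΣ sub-rung of A_∞ modulo the EVENTUAL small-modules alt-spanning property (family form)

Route MonotoneRestoration, crux `OrbitRestorationQP` (stmt-ValiantsHypothesis-18293), line `depth-three-rung`,
stub A_∞ `stub_sigmaPiSigmaValue`.  Namespace `Summit.ValiantsHypothesis.ValiantsHypothesis.Theorems.DerivativeTower`.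

The representation-theoretic input of `…DerivativeTowerWaringAlt.lean` (small matrix-stable modules are
spanned by alt-supported vectors) is a LARGE-`n` statement: for `dim ≤ n^c` it holds once `n ≥ n₀(c)` (minimal
degrees of `S_n`-modules grow like `n^{depth}`).  This file states the family form accordingly — the hypothesis
is required only from some level `n₀` on; smaller levels are restored by brute force
(`Restorable.qpOrbitRestorable_of_invariant`, constant `n! + 5 ≤ n₀! + 5`).

* `sigmaLambdaSigma_restoration_of_eventually_altSpanning` — **every matrix-symmetric family with
  `f n = Σ_{i<r_n} a_i ℓ_{w_i}^{d_n}` is quasi-polynomially orbit-restorable, PROVIDED the alt-spanning property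
  holds for matrix-stable subspaces of dimension `≤ r_n` at all levels `n ≥ n₀` with one `k`.**

Honest label: conditional (one explicit representation-theoretic hypothesis); A_∞ and the crux stay open;
VP ≠ VNP untouched. [folklore]
-/

noncomputable section

open scoped Classical

-- `Summit.ValiantsHypothesis.ValiantsHypothesis.…` is the tree's single-conjunct layout (Sub = Summit).
set_option linter.dupNamespace false

namespace Summit.ValiantsHypothesis.ValiantsHypothesis.Theorems

namespace DerivativeTower

open MvPolynomial Finset Equiv OrbitRestorationQPDepthThreeRung WaringJennrich LevelStructure

/-- **THE ΣΛΣ SUB-RUNG OF A_∞ MODULO THE EVENTUAL ALT-SPANNING PROPERTY.** [folklore] -/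
theorem sigmaLambdaSigma_restoration_of_eventually_altSpanning {k n₀ : ℕ}
    (f : (n : ℕ) → MvPolynomial (Fin n × Fin n) ℂ) (hsym : IsMatrixSymmetric f) (r d : ℕ → ℕ)
    (hKey : ∀ n : ℕ, n₀ ≤ n → ∀ W : Submodule ℂ (MvPolynomial (Fin n × Fin n) ℂ), FiniteDimensional ℂ W →
      Module.finrank ℂ W ≤ r n → (∀ σ τ : Perm (Fin n), ∀ w ∈ W, mact σ τ w ∈ W) →
        W ≤ Submodule.span ℂ {v | v ∈ W ∧ ∃ Y : Finset (Fin n), Y.card ≤ k ∧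
          ∀ ρ : Perm (Fin n), (∀ i ∈ Y, ρ i = i) → Perm.sign ρ = 1 → ren ρ v = v})
    (h : ∀ n : ℕ, ∃ (w : Fin (r n) → (Fin n × Fin n) → ℂ) (a : Fin (r n) → ℂ),
      f n = ∑ i, C (a i) * lin (w i) ^ (d n)) :
    ∃ c : ℕ, ∀ n : ℕ, QPOrbitRestorable c n (f n) := by
  refine ⟨n₀.factorial + k + 7, fun n => ?_⟩
  by_cases hn : n₀ ≤ n
  · obtain ⟨w, a, hf⟩ := h n
    refine Restorable.qpOrbitRestorable_mono (by omega)
      (sigmaLambdaSigma_restorable_of_smallModulesAltSupported (hKey n hn) w a hf fun σ τ => ?_)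
    rw [mact_apply]; exact hsym n σ τ
  · refine Restorable.qpOrbitRestorable_mono ?_
      (Restorable.qpOrbitRestorable_of_invariant (f n) fun σ => ValueOrbit.ren_eq_of_matrixSymmetric (hsym n) σ)
    have : n.factorial ≤ n₀.factorial := Nat.factorial_le (by omega)
    omega

end DerivativeTower

end Summit.ValiantsHypothesis.ValiantsHypothesis.Theorems

end
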